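import Summits.NavierStokesRegularity.NavierStokesRegularity.Theorems.AsymmetricFlickerLiouville.Negative.PowerLiouvilleIsFDL
import Summits.NavierStokesRegularity.NavierStokesRegularity.Theorems.LerayQuarterDissipationFiniteDissipationLiouvilleHardness
import HarnessLib

/-!
# Crux `AsymmetricFlickerLiouville` (stmt-NavierStokesRegularity-24453) and its parent
# `PerpetualFlickerLiouville` (stmt-24374): HARDNESS CERTIFICATES — both cruxes, and the line's open
# stub `stub_powerLiouville`, imply the catalogued Type-I DSS Liouville conjecture, and every Type-I
# (rotated) DSS profile refutes all three

Refuter-side negative-lane file (seat ns-afl-r1 g6, `--supports stmt-NavierStokesRegularity-24453`),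
closing the DSS-instrument dictionary for route `CalmSliceGate`: composition of
`…Negative.AsTypedIsFDL` (AFL ⟺ FDL ⟺ PFL, p629301), `…Negative.PowerLiouvilleIsFDL`
(`stub_powerLiouville`^∀ ⟺ FDL, p632705) with LQD's `…FiniteDissipationLiouvilleHardness`
(FDL ⇒ `TypeIDSSLiouvilleConjecture`; a Type-I (R)DSS profile refutes FDL).  Companion of the S3 file
`…Theorems.TypeIQuantSubcubicExp.Negative.ThinCascadeLiouvilleHardness` (p632891).
Navier–Stokes regularity is NOT proved here; no summit statement is; 24374, 24453, the stub and the
conjecture leaf stay OPEN; nothing here is a refutation (no DSS profile is exhibited — none is known: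
Bradshaw–Tsai 2017, Open Problem 5.1).

* `typeIDSSLiouvilleConjecture_of_asymmetricFlickerLiouville`,
  `typeIDSSLiouvilleConjecture_of_perpetualFlickerLiouville`,
  `typeIDSSLiouvilleConjecture_of_powerLiouville` — the three statements are each at least as hard as
  the sub-problem's `@[conjecture]` leaf (Tsai Conj. 8.8–8.9 / Bradshaw–Tsai OP 5.1, plain and rotated,
  every factor);
* `not_asymmetricFlickerLiouville_of_isTypeIDSSProfile`,
  `not_perpetualFlickerLiouville_of_isTypeIDSSProfile`, `not_powerLiouville_of_isTypeIDSSProfile` —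
  THE INSTRUMENT ROWS AS THEOREMS: a Type-I (rotated) DSS profile `IsTypeIDSSProfile c R u` refutes
  24453, 24374 and the stub outright;
* `not_asymmetricFlickerLiouville_of_not_typeIDSSLiouvilleConjecture` — a failure of the leaf
  refutes 24453.

Numbers, not adjectives: converged Type-I (R)DSS candidates today: 0 (VERDICT-TABLES-DSS-v1 + ADDENDUM A,
rows 0/9).  No definitions; standard axioms.
-/

noncomputable section

-- the summit and its single sub-problem share the name (CONVENTIONS §1), as in every Theorems file
set_option linter.dupNamespace false

namespace Summit.NavierStokesRegularity.NavierStokesRegularity.Theorems.AsymmetricFlickerLiouville.Negative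

open MeasureTheory Set Filter Topology Metric Function
open Literature.Analysis Literature.Analysis.FluidPDE
open Summit.NavierStokesRegularity.NavierStokesRegularity.Theorems
open Summit.NavierStokesRegularity.NavierStokesRegularity.Theorems.FiniteDissipationLiouville
open scoped ENNReal NNReal

/-- **24453 ⇒ the catalogued Type-I DSS Liouville conjecture.** [cite: BradshawTsai2017CPDE, §5 Open Problem 5.1] -/
theorem typeIDSSLiouvilleConjecture_of_asymmetricFlickerLiouville
    (h : Theses.CalmSliceGate.AsymmetricFlickerLiouville) :
    _root_.Summit.NavierStokesRegularity.NavierStokesRegularity.TypeIDSSLiouvilleConjecture :=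
  Hardness.typeIDSSLiouvilleConjecture_of_finiteDissipationLiouville
    (finiteDissipationLiouville_iff_asymmetricFlickerLiouville.2 h)

/-- **24374 ⇒ the catalogued Type-I DSS Liouville conjecture.** [cite: BradshawTsai2017CPDE, §5 Open Problem 5.1] -/
theorem typeIDSSLiouvilleConjecture_of_perpetualFlickerLiouville
    (h : Theses.CalmSliceGate.PerpetualFlickerLiouville) :
    _root_.Summit.NavierStokesRegularity.NavierStokesRegularity.TypeIDSSLiouvilleConjecture :=
  Hardness.typeIDSSLiouvilleConjecture_of_finiteDissipationLiouville
    (PerpetualFlickerLiouville.Links.finiteDissipationLiouville_iff_perpetualFlickerLiouville.2 h)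

/-- **`stub_powerLiouville` (closed over its parameters) ⇒ the catalogued Type-I DSS Liouville
conjecture.** [cite: BradshawTsai2017CPDE, §5 Open Problem 5.1] -/
theorem typeIDSSLiouvilleConjecture_of_powerLiouville
    (h : ∀ (C K c R c' R' : ℝ), 0 < c → 0 < R → 0 < c' → 0 < R' →
      ∀ (w : ℝ → EuclideanSpace ℝ (Fin 3) → EuclideanSpace ℝ (Fin 3)), IsTypeIAncientMild C w →
      (∀ s : ℝ, s < 0 → ∫⁻ x, ‖fderiv ℝ (w s) x‖ₑ ^ 2 ≤ ENNReal.ofReal (K / Real.sqrt (-s))) →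
      (∀ t < 0, ENNReal.ofReal (c * (-t) ^ (3 / 2 : ℝ)) ≤
        ∫⁻ x in Metric.ball (0 : EuclideanSpace ℝ (Fin 3)) (2 * R * Real.sqrt (-t)),
          ‖Real.sqrt (-t) • ((-t) • deriv (fun τ => w τ x) t - (1 / 2 : ℝ) • w t x -
            (1 / 2 : ℝ) • fderiv ℝ (w t) x x)‖ₑ ^ 2) →
      (∀ t < 0, ∀ g : EuclideanSpace ℝ (Fin 3) ≃ₗᵢ[ℝ] EuclideanSpace ℝ (Fin 3),
        ENNReal.ofReal (c' * (-t) ^ (3 / 2 : ℝ)) ≤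
          ∫⁻ x in Metric.ball (0 : EuclideanSpace ℝ (Fin 3)) (2 * R' * Real.sqrt (-t)),
            ‖Real.sqrt (-t) • deriv (fun θ : ℝ => w t (g (rotZ θ (g.symm x))) -
              g (rotZ θ (g.symm (w t x)))) 0‖ₑ ^ 2) →
      ¬ (∀ r > 0, ∀ M : ℝ, ∃ t ∈ Set.Ioo (-(r ^ 2)) (0 : ℝ),
        ∃ x ∈ Metric.ball (0 : EuclideanSpace ℝ (Fin 3)) r, M < ‖w t x‖)) :
    _root_.Summit.NavierStokesRegularity.NavierStokesRegularity.TypeIDSSLiouvilleConjecture :=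
  Hardness.typeIDSSLiouvilleConjecture_of_finiteDissipationLiouville
    (powerLiouville_iff_finiteDissipationLiouville.1 h)

/-- **A Type-I (rotated) DSS profile refutes 24453.** [folklore] -/
theorem not_asymmetricFlickerLiouville_of_isTypeIDSSProfile {c : ℝ}
    {R : EuclideanSpace ℝ (Fin 3) ≃ₗᵢ[ℝ] EuclideanSpace ℝ (Fin 3)}
    {u : ℝ → EuclideanSpace ℝ (Fin 3) → EuclideanSpace ℝ (Fin 3)} (h : IsTypeIDSSProfile c R u) :
    ¬ Theses.CalmSliceGate.AsymmetricFlickerLiouville :=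
  fun hAFL => Hardness.not_finiteDissipationLiouville_of_isTypeIDSSProfile h
    (finiteDissipationLiouville_iff_asymmetricFlickerLiouville.2 hAFL)

/-- **A Type-I (rotated) DSS profile refutes 24374.** [folklore] -/
theorem not_perpetualFlickerLiouville_of_isTypeIDSSProfile {c : ℝ}
    {R : EuclideanSpace ℝ (Fin 3) ≃ₗᵢ[ℝ] EuclideanSpace ℝ (Fin 3)}
    {u : ℝ → EuclideanSpace ℝ (Fin 3) → EuclideanSpace ℝ (Fin 3)} (h : IsTypeIDSSProfile c R u) :
    ¬ Theses.CalmSliceGate.PerpetualFlickerLiouville :=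
  fun hPFL => Hardness.not_finiteDissipationLiouville_of_isTypeIDSSProfile h
    (PerpetualFlickerLiouville.Links.finiteDissipationLiouville_iff_perpetualFlickerLiouville.2 hPFL)

/-- **A Type-I (rotated) DSS profile refutes `stub_powerLiouville` (closed over its parameters).**
[folklore] -/
theorem not_powerLiouville_of_isTypeIDSSProfile {c₀ : ℝ}
    {R₀ : EuclideanSpace ℝ (Fin 3) ≃ₗᵢ[ℝ] EuclideanSpace ℝ (Fin 3)}
    {u : ℝ → EuclideanSpace ℝ (Fin 3) → EuclideanSpace ℝ (Fin 3)} (h : IsTypeIDSSProfile c₀ R₀ u) :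
    ¬ (∀ (C K c R c' R' : ℝ), 0 < c → 0 < R → 0 < c' → 0 < R' →
      ∀ (w : ℝ → EuclideanSpace ℝ (Fin 3) → EuclideanSpace ℝ (Fin 3)), IsTypeIAncientMild C w →
      (∀ s : ℝ, s < 0 → ∫⁻ x, ‖fderiv ℝ (w s) x‖ₑ ^ 2 ≤ ENNReal.ofReal (K / Real.sqrt (-s))) →
      (∀ t < 0, ENNReal.ofReal (c * (-t) ^ (3 / 2 : ℝ)) ≤
        ∫⁻ x in Metric.ball (0 : EuclideanSpace ℝ (Fin 3)) (2 * R * Real.sqrt (-t)),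
          ‖Real.sqrt (-t) • ((-t) • deriv (fun τ => w τ x) t - (1 / 2 : ℝ) • w t x -
            (1 / 2 : ℝ) • fderiv ℝ (w t) x x)‖ₑ ^ 2) →
      (∀ t < 0, ∀ g : EuclideanSpace ℝ (Fin 3) ≃ₗᵢ[ℝ] EuclideanSpace ℝ (Fin 3),
        ENNReal.ofReal (c' * (-t) ^ (3 / 2 : ℝ)) ≤
          ∫⁻ x in Metric.ball (0 : EuclideanSpace ℝ (Fin 3)) (2 * R' * Real.sqrt (-t)),
            ‖Real.sqrt (-t) • deriv (fun θ : ℝ => w t (g (rotZ θ (g.symm x))) -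
              g (rotZ θ (g.symm (w t x)))) 0‖ₑ ^ 2) →
      ¬ (∀ r > 0, ∀ M : ℝ, ∃ t ∈ Set.Ioo (-(r ^ 2)) (0 : ℝ),
        ∃ x ∈ Metric.ball (0 : EuclideanSpace ℝ (Fin 3)) r, M < ‖w t x‖)) :=
  fun hPL => Hardness.not_finiteDissipationLiouville_of_isTypeIDSSProfile h
    (powerLiouville_iff_finiteDissipationLiouville.1 hPL)

/-- **A failure of the conjecture leaf refutes 24453** (contrapositive hardness, for the disprover's
ledger). [folklore] -/
theorem not_asymmetricFlickerLiouville_of_not_typeIDSSLiouvilleConjecture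
    (h : ¬ _root_.Summit.NavierStokesRegularity.NavierStokesRegularity.TypeIDSSLiouvilleConjecture) :
    ¬ Theses.CalmSliceGate.AsymmetricFlickerLiouville :=
  fun hAFL => h (typeIDSSLiouvilleConjecture_of_asymmetricFlickerLiouville hAFL)

end Summit.NavierStokesRegularity.NavierStokesRegularity.Theorems.AsymmetricFlickerLiouville.Negative

end
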